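import Literature.Probability.Divergences.FDivergence
import HarnessLib

/-!
# The variational (Fenchel–Young) lower bound for `f`-divergences

Topic `Literature/Probability/Divergences`; companion of `FDivergence.lean` (definition item
`defn-fDiv` asked for "the variational (Fenchel) formula … for probability measures").

[PolyanskiyWu2024, Thm. 7.26] states `D_f(P ‖ Q) = sup_g E_P[g(X)] - E_Q[f*_ext(g(X))]` with
`f*` the convex conjugate `f*(y) = sup_{x ≥ 0} (x y - f(x))` ([PolyanskiyWu2024, eq. (7.84)]).
This file PROVES the half of it that is used to control observables by divergences — the
inequality `E_P[g] ≤ D_f(P ‖ Q) + E_Q[f*(g)]` for every `g` — in the following robust form: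
`f*` may be ANY function satisfying the Fenchel–Young inequality `x y ≤ f x + f* y` for `x ≥ 0`
(the conjugate (7.84) is the least such), `P ≪ Q` are measures with `P` σ-finite, `D_f(P‖Q) < ∞`,
`g` is `P`-integrable and `f* ∘ g` is `Q`-integrable. The proof is the source's one-line
argument: integrate `(dP/dQ) · g ≤ f(dP/dQ) + f*(g)` against `Q`.

## Contents (all proved)

* `integral_le_toReal_fDiv_add_integral` — `∫ g dμ ≤ D_f(μ‖ν) + ∫ f*(g) dν` for `μ ≪ ν`.
* `integral_le_toReal_fDiv_add_integral_of_le` — the same for a finite `μ` with a `ν`-singular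
  part, for `g ≤ c ≤ f'(∞)` (the source's restriction of `g` to `dom f*_ext`).
* `integral_le_inv_mul_fDiv` — the scaled/shifted form
  `∫ Z dμ ≤ γ⁻¹ (D_f(μ‖ν) + ∫ f*(γ Z - c) dν + c)` for a probability measure `μ`, `γ > 0`.
* `klFun_fenchelYoung` — `x y ≤ klFun x + (e^y - 1)` (`e^y - 1` is the conjugate of
  `klFun = x log x + 1 - x`), and the Kullback–Leibler instance
  `integral_le_toReal_klDiv_add_integral` — `∫ g dμ ≤ KL(μ‖ν) + ∫ (e^g - 1) dν` for finite
  measures with `KL(μ‖ν) < ∞` (a Gibbs/Donsker–Varadhan-type bound stated for Mathlib's `klDiv`).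

Not here: the supremum (equality) half of Thm. 7.26, which needs the biconjugate theorem and the
approximation argument of [PolyanskiyWu2024, §7.14*].
-/

noncomputable section

open _root_.MeasureTheory _root_.InformationTheory Set
open scoped ENNReal

namespace Literature.Probability.Divergences

variable {α : Type*} [MeasurableSpace α]

/-- For a superlinear generator (`f'(∞) = ∞`) finiteness of `D_f(μ ‖ ν)` forces `μ ≪ ν`, so the
absolutely continuous form of the variational bound below applies. [folklore] -/
theorem ac_of_fDiv_ne_top {f : ℝ → ℝ} {μ ν : Measure α} [μ.HaveLebesgueDecomposition ν]
    (hf : derivAtTop f = ∞) (h : fDiv f μ ν ≠ ∞) : μ ≪ ν := by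
  by_contra hac
  exact h (fDiv_eq_top_of_not_ac hf hac)

/-- **Variational lower bound for `f`-divergences** (Fenchel–Young): if `x y ≤ f x + f* y` for
all `x ≥ 0`, `y`, then for `μ ≪ ν` with `D_f(μ ‖ ν) < ∞`, every `μ`-integrable `g` with
`f* ∘ g` `ν`-integrable satisfies `∫ g dμ ≤ D_f(μ ‖ ν) + ∫ f*(g) dν`.
[cite: PolyanskiyWu2024, Thm. 7.26 (lower-bound half, eq. (7.87))] -/
theorem integral_le_toReal_fDiv_add_integral {f fstar : ℝ → ℝ} (hfm : Measurable f)
    (hf0 : ∀ x, 0 ≤ x → 0 ≤ f x) (hFY : ∀ x, 0 ≤ x → ∀ y, x * y ≤ f x + fstar y)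
    {μ ν : Measure α} [μ.HaveLebesgueDecomposition ν] [SigmaFinite μ] (hμν : μ ≪ ν)
    (hfin : fDiv f μ ν ≠ ∞) {g : α → ℝ} (hg : Integrable g μ)
    (hfg : Integrable (fun x => fstar (g x)) ν) :
    ∫ x, g x ∂μ ≤ (fDiv f μ ν).toReal + ∫ x, fstar (g x) ∂ν := by
  set r : α → ℝ := fun x => (μ.rnDeriv ν x).toReal with hr
  have hr0 : ∀ x, 0 ≤ r x := fun x => ENNReal.toReal_nonneg
  have hfr_meas : AEStronglyMeasurable (fun x => f (r x)) ν :=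
    (hfm.comp (Measure.measurable_rnDeriv μ ν).ennreal_toReal).aestronglyMeasurable
  have hfr_nonneg : 0 ≤ᵐ[ν] fun x => f (r x) := ae_of_all _ fun x => hf0 _ (hr0 x)
  have hD : fDiv f μ ν = ∫⁻ x, ENNReal.ofReal (f (r x)) ∂ν := fDiv_of_ac hμν
  have hfr_int : Integrable (fun x => f (r x)) ν := by
    rw [← lintegral_ofReal_ne_top_iff_integrable hfr_meas hfr_nonneg, ← hD]
    exact hfin
  have hD' : (fDiv f μ ν).toReal = ∫ x, f (r x) ∂ν := by
    rw [hD, integral_eq_lintegral_of_nonneg_ae hfr_nonneg hfr_meas]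
  have hrg_int : Integrable (fun x => r x * g x) ν :=
    (integrable_toReal_rnDeriv_mul_iff hμν).mpr hg
  have hchange : ∫ x, g x ∂μ = ∫ x, r x * g x ∂ν := (integral_toReal_rnDeriv_mul hμν).symm
  rw [hchange, hD', ← integral_add hfr_int hfg]
  exact integral_mono hrg_int (hfr_int.add hfg) fun x => hFY _ (hr0 x) _

/-- **Variational lower bound for `f`-divergences, general form** (with a `ν`-singular part of
`μ`): if `x y ≤ f x + f* y` for `x ≥ 0`, `g ≤ c` pointwise with `c ≤ f'(∞)` (i.e. `g` takes
values in the effective domain `(-∞, f'(∞)]` of the conjugate of the extension of `f` by `+∞` on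
the negatives), and `D_f(μ ‖ ν) < ∞`, then `∫ g dμ ≤ D_f(μ ‖ ν) + ∫ f*(g) dν` for a finite measure
`μ` and any `ν` (the singular mass `μ^⊥(univ)` is charged `≤ c · μ^⊥(univ) ≤ f'(∞) · μ^⊥(univ)`).
[cite: PolyanskiyWu2024, Thm. 7.26 (lower-bound half, eq. (7.87))] -/
theorem integral_le_toReal_fDiv_add_integral_of_le {f fstar : ℝ → ℝ} (hfm : Measurable f)
    (hf0 : ∀ x, 0 ≤ x → 0 ≤ f x) (hFY : ∀ x, 0 ≤ x → ∀ y, x * y ≤ f x + fstar y)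
    {μ ν : Measure α} [IsFiniteMeasure μ] [μ.HaveLebesgueDecomposition ν]
    (hfin : fDiv f μ ν ≠ ∞) {g : α → ℝ} (hg : Integrable g μ)
    (hfg : Integrable (fun x => fstar (g x)) ν) {c : ℝ} (hgc : ∀ x, g x ≤ c)
    (hc : ENNReal.ofReal c ≤ derivAtTop f) :
    ∫ x, g x ∂μ ≤ (fDiv f μ ν).toReal + ∫ x, fstar (g x) ∂ν := by
  set r : α → ℝ := fun x => (μ.rnDeriv ν x).toReal with hr
  have hr0 : ∀ x, 0 ≤ r x := fun x => ENNReal.toReal_nonneg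
  have hrlt : ∀ᵐ x ∂ν, μ.rnDeriv ν x < ∞ := Measure.rnDeriv_lt_top μ ν
  -- the two parts of `μ` and of `D_f`
  set μs : Measure α := μ.singularPart ν with hμs
  set μc : Measure α := ν.withDensity (μ.rnDeriv ν) with hμc
  have hdec : μ = μs + μc := Measure.haveLebesgueDecomposition_add μ ν
  have hI_ne : ∫⁻ x, ENNReal.ofReal (f (r x)) ∂ν ≠ ∞ :=
    ne_top_of_le_ne_top hfin (lintegral_le_fDiv f μ ν)
  have hS_ne : derivAtTop f * μs univ ≠ ∞ :=
    ne_top_of_le_ne_top hfin (derivAtTop_mul_singularPart_le_fDiv f μ ν)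
  have hD : (fDiv f μ ν).toReal
      = (∫⁻ x, ENNReal.ofReal (f (r x)) ∂ν).toReal + (derivAtTop f * μs univ).toReal := by
    rw [fDiv_def, ENNReal.toReal_add hI_ne hS_ne]
  -- absolutely continuous part: Fenchel–Young under the integral
  have hfr_meas : AEStronglyMeasurable (fun x => f (r x)) ν :=
    (hfm.comp (Measure.measurable_rnDeriv μ ν).ennreal_toReal).aestronglyMeasurable
  have hfr_nonneg : 0 ≤ᵐ[ν] fun x => f (r x) := ae_of_all _ fun x => hf0 _ (hr0 x)
  have hfr_int : Integrable (fun x => f (r x)) ν :=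
    (lintegral_ofReal_ne_top_iff_integrable hfr_meas hfr_nonneg).mp hI_ne
  have hI : (∫⁻ x, ENNReal.ofReal (f (r x)) ∂ν).toReal = ∫ x, f (r x) ∂ν := by
    rw [integral_eq_lintegral_of_nonneg_ae hfr_nonneg hfr_meas]
  have hgc_int : Integrable g μc := hg.mono_measure (Measure.withDensity_rnDeriv_le μ ν)
  have hrg_int : Integrable (fun x => r x * g x) ν := by
    have h := (integrable_withDensity_iff_integrable_smul' (Measure.measurable_rnDeriv μ ν)
      hrlt).mp hgc_int
    simpa only [smul_eq_mul] using h
  have hac : ∫ x, g x ∂μc = ∫ x, r x * g x ∂ν := by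
    rw [hμc, integral_withDensity_eq_integral_toReal_smul (Measure.measurable_rnDeriv μ ν) hrlt]
    simp only [smul_eq_mul, hr]
  have hac_le : ∫ x, g x ∂μc ≤ ∫ x, f (r x) ∂ν + ∫ x, fstar (g x) ∂ν := by
    rw [hac, ← integral_add hfr_int hfg]
    exact integral_mono hrg_int (hfr_int.add hfg) fun x => hFY _ (hr0 x) _
  -- singular part: `∫ g dμs ≤ c · μs(univ) ≤ (f'(∞) · μs(univ)).toReal`
  have hgs_int : Integrable g μs := hg.mono_measure (Measure.singularPart_le μ ν)
  haveI : IsFiniteMeasure μs := isFiniteMeasure_of_le μ (Measure.singularPart_le μ ν)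
  have hs_le : ∫ x, g x ∂μs ≤ (derivAtTop f * μs univ).toReal := by
    calc ∫ x, g x ∂μs ≤ ∫ _, c ∂μs := integral_mono hgs_int (integrable_const c) hgc
      _ = c * μs.real univ := by rw [integral_const, smul_eq_mul, mul_comm]
      _ ≤ (derivAtTop f * μs univ).toReal := by
        by_cases h0 : μs univ = 0
        · simp [Measure.real, h0]
        · have hdf : derivAtTop f ≠ ∞ := fun htop => hS_ne (by rw [htop, ENNReal.top_mul h0])
          rw [ENNReal.toReal_mul]
          exact mul_le_mul_of_nonneg_right ((ENNReal.ofReal_le_iff_le_toReal hdf).mp hc)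
            ENNReal.toReal_nonneg
  -- assemble
  have hsplit : ∫ x, g x ∂μ = ∫ x, g x ∂μs + ∫ x, g x ∂μc := by
    conv_lhs => rw [hdec]
    exact integral_add_measure hgs_int hgc_int
  rw [hsplit, hD, hI]
  linarith

/-- The scaled and shifted form of the variational lower bound for a probability measure `μ`:
`∫ Z dμ ≤ γ⁻¹ · (D_f(μ ‖ ν) + ∫ f*(γ Z - c) dν + c)` for `γ > 0`, `c ∈ ℝ` (apply the bound to
`g = γ Z - c`). [cite: PolyanskiyWu2024, Thm. 7.26 (lower-bound half, eq. (7.87))] -/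
theorem integral_le_inv_mul_fDiv {f fstar : ℝ → ℝ} (hfm : Measurable f)
    (hf0 : ∀ x, 0 ≤ x → 0 ≤ f x) (hFY : ∀ x, 0 ≤ x → ∀ y, x * y ≤ f x + fstar y)
    {μ ν : Measure α} [IsProbabilityMeasure μ] [μ.HaveLebesgueDecomposition ν] (hμν : μ ≪ ν)
    (hfin : fDiv f μ ν ≠ ∞) {Z : α → ℝ} (hZ : Integrable Z μ) {γ : ℝ} (hγ : 0 < γ) (c : ℝ)
    (hfZ : Integrable (fun x => fstar (γ * Z x - c)) ν) :
    ∫ x, Z x ∂μ ≤ γ⁻¹ * ((fDiv f μ ν).toReal + ∫ x, fstar (γ * Z x - c) ∂ν + c) := by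
  have hg : Integrable (fun x => γ * Z x - c) μ := (hZ.const_mul γ).sub (integrable_const c)
  have h := integral_le_toReal_fDiv_add_integral hfm hf0 hFY hμν hfin hg hfZ
  rw [integral_sub (hZ.const_mul γ) (integrable_const c), integral_const_mul, integral_const,
    probReal_univ, one_smul] at h
  rw [le_inv_mul_iff₀ hγ]
  linarith

/-- **Fenchel–Young for the Kullback–Leibler generator**: `x y ≤ klFun x + (e^y - 1)` for `x ≥ 0`
(`y ↦ e^y - 1` is the convex conjugate of `klFun x = x log x + 1 - x` on `x ≥ 0`). [folklore] -/
theorem klFun_fenchelYoung {x : ℝ} (hx : 0 ≤ x) (y : ℝ) : x * y ≤ klFun x + (Real.exp y - 1) := by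
  rw [klFun_apply]
  rcases hx.eq_or_lt with rfl | hx
  · simp [Real.exp_nonneg]
  · -- `e^y = x e^{y - log x} ≥ x (1 + y - log x)`
    have h1 : x * (y - Real.log x + 1) ≤ x * Real.exp (y - Real.log x) :=
      mul_le_mul_of_nonneg_left (by linarith [Real.add_one_le_exp (y - Real.log x)]) hx.le
    have h2 : x * Real.exp (y - Real.log x) = Real.exp y := by
      rw [Real.exp_sub, Real.exp_log hx]
      field_simp
    nlinarith [h1, h2]

/-- **Variational lower bound for the Kullback–Leibler divergence** (Gibbs / Donsker–Varadhan
type, for Mathlib's `klDiv`): for finite measures with `KL(μ ‖ ν) < ∞`, every `μ`-integrable `g`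
with `e^g` `ν`-integrable satisfies `∫ g dμ ≤ KL(μ ‖ ν) + ∫ (e^g - 1) dν`.
[cite: PolyanskiyWu2024, Thm. 7.26 (lower-bound half) with f = klFun] -/
theorem integral_le_toReal_klDiv_add_integral {μ ν : Measure α} [IsFiniteMeasure μ]
    [IsFiniteMeasure ν] (hfin : klDiv μ ν ≠ ∞) {g : α → ℝ} (hg : Integrable g μ)
    (hexp : Integrable (fun x => Real.exp (g x)) ν) :
    ∫ x, g x ∂μ ≤ (klDiv μ ν).toReal + ∫ x, (Real.exp (g x) - 1) ∂ν := by
  have hμν : μ ≪ ν := (klDiv_ne_top_iff.mp hfin).1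
  rw [klDiv_eq_fDiv] at hfin ⊢
  exact integral_le_toReal_fDiv_add_integral measurable_klFun (fun x hx => klFun_nonneg hx)
    (fun x hx y => klFun_fenchelYoung hx y) hμν hfin hg (hexp.sub (integrable_const 1))

end Literature.Probability.Divergences
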